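/-
VALUE = THEOREM (a faster evaluation form of the reflection-class certificate: weight table +
scalar representatives + sphere-only orbit test), NOT summit progress (cell b2b-lgcu-borel,
gen 23); the crux item stmt-MatrixMultiplication-14079 is untouched.
-/
import Mathlib
import Summits.MatrixMultiplication.MatrixMultiplication.Theorems.SubgroupIdentityDesigns.Negative.ReflectionClassCertificate

/-!
# Reflection classes of `GL₃(𝔽_p)`: the fast certificate

VALUE = THEOREM (generic in `p`), NOT summit progress; the crux item stmt-MatrixMultiplication-14079
is untouched and remains open.

Two evaluation bottlenecks of `ReflectionClassCertificate.cert (KS p σ)` are removed here.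
(1) `ReflectionClassCertificate.norm` re-materialises a unit through the FUNCTION-valued helper
`mat9`, which compiled code η-expands: entries of iterated products are recomputed from the
leaves, so `KS p σ` (words of length `4`) does not evaluate in practice (`(KS 5 false).card`
exceeds 240 s).  `normF` materialises into STRUCTURE FIELDS (entries evaluated once), and
`KSF p σ` is the same word set built with it (`KSF_sub`, `KSF_mul_of_step` as for `KS`).
(2) `cert` costs `Θ(p⁶)` weight evaluations; `certF` evaluates the same certificate (i) with
the weight read from a table (`table`, re-checked entrywise at run time, so no decoding lemma is
needed), (ii) only for the `p² + p + 1` scalar representatives `x` (`nrm x`: first non-zero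
coordinate `1`; the stabilisers of `x` and `t·x` coincide, `filter_smul`), (iii) only for `ω`
on the sphere (off the sphere every term vanishes, `ReflectionClassCertificate.dot_act`).
Soundness: `no_design_of_certF` and the member forms `no_design_sq_memᵢ_of_certF` /
`no_design_nsq_memᵢ_of_certF` (`m ≥ 3`), with the same conclusions as the slow forms.
Timings (whole file, farm): `p = 5`: 15 s, `p = 7`: 24 s, `p = 11`: 407 s (the remaining cost
is the quadratic deduplication inside `Finset.image`; a hashed closure is the successor's cure).
Instances: `SquareReflectionsSeven` (`p = 7`), `SquareReflectionsEleven` (`p = 11`).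

HONEST SCOPE.  A reduction; by itself it excludes nothing.
-/

set_option linter.dupNamespace false

open scoped BigOperators Matrix

namespace Summit.MatrixMultiplication.MatrixMultiplication.Theorems.SubgroupIdentityDesigns.Negative
namespace ReflectionClassCertificateFast

open Summit.MatrixMultiplication.MatrixMultiplication.Theorems.LieRankDesigns.Negative (GLm Mat)
open NonsquareReflections (refl extVec extVec_dotProduct emb_refl)
open SummandTransport (emb design_comap)
open PermutationCertificate (no_design_of_permCert)
open ReflectionClassCertificate (V det3 act act_mul act_one dot_act wt wt_off classGroup)

variable {p : ℕ} [hp : Fact p.Prime]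

/-! ## A field-wise materialiser and the fast word closure -/

/-- Re-materialise a unit of `GL₃(𝔽_p)` entrywise INTO STRUCTURE FIELDS (entries are evaluated
once when the structure is built; compare `ReflectionClassCertificate.norm`). -/
def normF (g : GLm p 3) : GLm p 3 where
  val := !![(g : Mat p 3) 0 0, (g : Mat p 3) 0 1, (g : Mat p 3) 0 2;
            (g : Mat p 3) 1 0, (g : Mat p 3) 1 1, (g : Mat p 3) 1 2;
            (g : Mat p 3) 2 0, (g : Mat p 3) 2 1, (g : Mat p 3) 2 2]
  inv := !![((g⁻¹ : GLm p 3) : Mat p 3) 0 0, ((g⁻¹ : GLm p 3) : Mat p 3) 0 1,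
              ((g⁻¹ : GLm p 3) : Mat p 3) 0 2;
            ((g⁻¹ : GLm p 3) : Mat p 3) 1 0, ((g⁻¹ : GLm p 3) : Mat p 3) 1 1,
              ((g⁻¹ : GLm p 3) : Mat p 3) 1 2;
            ((g⁻¹ : GLm p 3) : Mat p 3) 2 0, ((g⁻¹ : GLm p 3) : Mat p 3) 2 1,
              ((g⁻¹ : GLm p 3) : Mat p 3) 2 2]
  val_inv := by
    have h : (g : Mat p 3) * ((g⁻¹ : GLm p 3) : Mat p 3) = 1 := by
      rw [← Units.val_mul, mul_inv_cancel, Units.val_one]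
    rw [← h]
    congr 1 <;> exact Matrix.ext fun i j => by fin_cases i <;> fin_cases j <;> rfl
  inv_val := by
    have h : ((g⁻¹ : GLm p 3) : Mat p 3) * (g : Mat p 3) = 1 := by
      rw [← Units.val_mul, inv_mul_cancel, Units.val_one]
    rw [← h]
    congr 1 <;> exact Matrix.ext fun i j => by fin_cases i <;> fin_cases j <;> rfl

/-- `normF g = g`. -/
theorem normF_eq (g : GLm p 3) : normF g = g :=
  Units.ext (Matrix.ext fun i j => by fin_cases i <;> fin_cases j <;> rfl)

/-- The reflections of the class `σ` (`true`: `b·b` a non-zero square; `false`: a non-square),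
materialised field-wise. -/
def RF (p : ℕ) [Fact p.Prime] (σ : Bool) : Finset (GLm p 3) :=
  (Finset.univ.filter fun b : V p => b ⬝ᵥ b ≠ 0 ∧ decide (IsSquare (b ⬝ᵥ b)) = σ).image
    fun b => normF (refl b)

/-- One closure step `S ↦ S ∪ S·R`, products materialised field-wise. -/
def stepF (σ : Bool) (S : Finset (GLm p 3)) : Finset (GLm p 3) :=
  S ∪ (S ×ˢ RF p σ).image fun ab => normF (ab.1 * ab.2)

/-- The words of length `≤ 4` in the reflections of the class `σ`, fast form. -/
def KSF (p : ℕ) [Fact p.Prime] (σ : Bool) : Finset (GLm p 3) :=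
  stepF σ (stepF σ (stepF σ (stepF σ {1})))

/-- `1 ∈ KSF`. -/
theorem one_mem_KSF (σ : Bool) : (1 : GLm p 3) ∈ KSF p σ :=
  Finset.subset_union_left (Finset.subset_union_left (Finset.subset_union_left
    (Finset.subset_union_left (Finset.mem_singleton_self 1))))

/-- A subgroup containing the reflections of the class and `S` contains `stepF S`. -/
theorem stepF_sub {σ : Bool} {H : Subgroup (GLm p 3)}
    (hR : ∀ b : V p, b ⬝ᵥ b ≠ 0 → decide (IsSquare (b ⬝ᵥ b)) = σ → refl b ∈ H)
    {S : Finset (GLm p 3)} (hS : ∀ k ∈ S, k ∈ H) : ∀ k ∈ stepF σ S, k ∈ H := by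
  intro k hk
  unfold stepF at hk
  rcases Finset.mem_union.mp hk with hk | hk
  · exact hS k hk
  · obtain ⟨ab, hab, rfl⟩ := Finset.mem_image.mp hk
    obtain ⟨ha, hb⟩ := Finset.mem_product.mp hab
    unfold RF at hb
    obtain ⟨b, hb', hbe⟩ := Finset.mem_image.mp hb
    rw [normF_eq, ← hbe, normF_eq]
    exact H.mul_mem (hS _ ha) (hR b (Finset.mem_filter.mp hb').2.1 (Finset.mem_filter.mp hb').2.2)

/-- **`KSF` lies in every subgroup containing the reflections of the class.** -/
theorem KSF_sub {σ : Bool} {H : Subgroup (GLm p 3)}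
    (hR : ∀ b : V p, b ⬝ᵥ b ≠ 0 → decide (IsSquare (b ⬝ᵥ b)) = σ → refl b ∈ H) :
    ∀ k ∈ KSF p σ, k ∈ H :=
  stepF_sub hR (stepF_sub hR (stepF_sub hR (stepF_sub hR fun k hk => by
    rw [Finset.mem_singleton.mp hk]; exact H.one_mem)))

/-- Induction step for closure under products (`KSF·R ⊆ KSF` and `KSF·S ⊆ KSF` give
`KSF·stepF S ⊆ KSF`). -/
theorem mul_stepF {σ : Bool} {S : Finset (GLm p 3)}
    (h : ∀ k ∈ KSF p σ, ∀ r ∈ RF p σ, k * r ∈ KSF p σ)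
    (hS : ∀ a ∈ KSF p σ, ∀ b ∈ S, a * b ∈ KSF p σ) :
    ∀ a ∈ KSF p σ, ∀ b ∈ stepF σ S, a * b ∈ KSF p σ := by
  intro a ha b hb
  unfold stepF at hb
  rcases Finset.mem_union.mp hb with hb | hb
  · exact hS a ha b hb
  · obtain ⟨ab, hab, rfl⟩ := Finset.mem_image.mp hb
    obtain ⟨h1, h2⟩ := Finset.mem_product.mp hab
    rw [normF_eq, ← mul_assoc]
    exact h _ (hS a ha _ h1) _ h2

/-- **Closure of `KSF` under products from the one-step check `KSF·R ⊆ KSF`.** -/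
theorem KSF_mul_of_step {σ : Bool}
    (hst : ((KSF p σ ×ˢ RF p σ).filter fun kr => ¬ normF (kr.1 * kr.2) ∈ KSF p σ) = ∅) :
    ∀ a ∈ KSF p σ, ∀ b ∈ KSF p σ, a * b ∈ KSF p σ := by
  have h : ∀ k ∈ KSF p σ, ∀ r ∈ RF p σ, k * r ∈ KSF p σ := fun k hk r hr => by
    have h' := not_not.mp (Finset.filter_eq_empty_iff.mp hst (Finset.mk_mem_product hk hr))
    rwa [normF_eq] at h'
  have h0 : ∀ a ∈ KSF p σ, ∀ b ∈ ({1} : Finset (GLm p 3)), a * b ∈ KSF p σ :=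
    fun a ha b hb => by rw [Finset.mem_singleton.mp hb, mul_one]; exact ha
  intro a ha b hb
  have hb' : b ∈ stepF σ (stepF σ (stepF σ (stepF σ {1}))) := hb
  exact mul_stepF h (mul_stepF h (mul_stepF h (mul_stepF h h0))) a ha b hb'

/-- Closure under inverses from the emptiness of the exception filter (any `S`). -/
theorem inv_of_filter {S : Finset (GLm p 3)} (hinv : (S.filter fun a => ¬ a⁻¹ ∈ S) = ∅) :
    ∀ a ∈ S, a⁻¹ ∈ S := fun _ ha =>
  not_not.mp (Finset.filter_eq_empty_iff.mp hinv ha)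

/-! ## Table, representatives, test -/

/-- Numeric code of a vector of `𝔽_p³`. -/
def encode (v : V p) : ℕ := (v 0).val + p * (v 1).val + p * p * (v 2).val

/-- A vector from a code (used only to FILL the table; the table is re-checked entrywise). -/
def decode (p : ℕ) [Fact p.Prime] (i : ℕ) : V p :=
  ![((i % p : ℕ) : ZMod p), ((i / p % p : ℕ) : ZMod p), ((i / (p * p) : ℕ) : ZMod p)]

/-- The weight table of `wt c X₀`. -/
def table (c : ZMod p) (X₀ : V p) : Array ℤ :=
  Array.ofFn fun i : Fin (p * p * p) => wt c X₀ (decode p i)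

/-- Table lookup. -/
def wtab (T : Array ℤ) (v : V p) : ℤ := T.getD (encode v) 0

/-- Scalar representatives: first non-zero coordinate equal to `1` (Boolean test). -/
def nrm (x : V p) : Bool :=
  decide (x 0 = 1 ∨ (x 0 = 0 ∧ x 1 = 1) ∨ (x 0 = 0 ∧ x 1 = 0 ∧ x 2 = 1))

/-- Every non-zero vector has a normalised scalar multiple. -/
theorem exists_nrm (x : V p) (hx : x ≠ 0) : ∃ t : ZMod p, t ≠ 0 ∧ nrm (t • x) = true := by
  simp only [nrm, decide_eq_true_eq]
  by_cases h0 : x 0 = 0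
  · by_cases h1 : x 1 = 0
    · have h2 : x 2 ≠ 0 := fun h2 => hx (by
        funext i; fin_cases i
        · exact h0
        · exact h1
        · exact h2)
      exact ⟨(x 2)⁻¹, inv_ne_zero h2, Or.inr (Or.inr ⟨by simp [h0], by simp [h1],
        by simp [inv_mul_cancel₀ h2]⟩)⟩
    · exact ⟨(x 1)⁻¹, inv_ne_zero h1, Or.inr (Or.inl ⟨by simp [h0], by simp [inv_mul_cancel₀ h1]⟩)⟩
  · exact ⟨(x 0)⁻¹, inv_ne_zero h0, Or.inl (by simp [inv_mul_cancel₀ h0])⟩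

/-- The stabiliser of `t • x` is the stabiliser of `x` (`t ≠ 0`). -/
theorem filter_smul (S : Finset (GLm p 3)) {t : ZMod p} (ht : t ≠ 0) (x : V p) :
    S.filter (fun s : GLm p 3 => (s : Mat p 3) *ᵥ (t • x) = t • x) =
      S.filter (fun s : GLm p 3 => (s : Mat p 3) *ᵥ x = x) := by
  refine Finset.filter_congr fun s _ => ?_
  rw [Matrix.mulVec_smul]
  exact (smul_right_injective (Fin 3 → ZMod p) ht).eq_iff

/-- The orbit-sum test at one `x` over the sphere `Ω`, weights from the table `T`. -/
def orbitTestF (S : Finset (GLm p 3)) (Ω : Finset (V p)) (T : Array ℤ) (x : V p) : Bool :=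
  let Sx := S.filter fun s : GLm p 3 => (s : Mat p 3) *ᵥ x = x
  decide ((Ω.filter fun ω => (∑ s ∈ Sx, wtab T (act s ω)) ≠ 0) = ∅)

/-- **THE FAST CERTIFICATE**: closure checks as in `cert`, `w(X₀) ≠ 0`, the table is correct, and
every normalised `x` passes the sphere orbit test. -/
def certF (S : Finset (GLm p 3)) (σ : Bool) (c : ZMod p) (X₀ : V p) : Bool :=
  let Ω := (Finset.univ : Finset (V p)).filter fun ω => ω ⬝ᵥ ω = c
  let T := table c X₀
  decide (((S ×ˢ RF p σ).filter fun kr => ¬ normF (kr.1 * kr.2) ∈ S) = ∅) &&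
  (decide ((S.filter fun a => ¬ a⁻¹ ∈ S) = ∅) &&
  (decide ((S.filter fun k : GLm p 3 => ¬ (((k : Mat p 3))ᵀ * (k : Mat p 3) = 1 ∧
      det3 (k : Mat p 3) * det3 (k : Mat p 3) = 1)) = ∅) &&
  (decide (wt c X₀ X₀ ≠ 0) &&
  (decide (∀ v : V p, wtab T v = wt c X₀ v) &&
  decide (∀ x : V p, nrm x = true → orbitTestF S Ω T x = true)))))

/-- Unpacking a verified fast certificate. -/
theorem certF_spec {S : Finset (GLm p 3)} {σ : Bool} {c : ZMod p} {X₀ : V p}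
    (h : certF S σ c X₀ = true) :
    ((S ×ˢ RF p σ).filter fun kr => ¬ normF (kr.1 * kr.2) ∈ S) = ∅ ∧
    (S.filter fun a => ¬ a⁻¹ ∈ S) = ∅ ∧
    (S.filter fun k : GLm p 3 => ¬ (((k : Mat p 3))ᵀ * (k : Mat p 3) = 1 ∧
      det3 (k : Mat p 3) * det3 (k : Mat p 3) = 1)) = ∅ ∧
    wt c X₀ X₀ ≠ 0 ∧ (∀ v : V p, wtab (table c X₀) v = wt c X₀ v) ∧
    ∀ x : V p, nrm x = true → orbitTestF S ((Finset.univ : Finset (V p)).filter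
      fun ω => ω ⬝ᵥ ω = c) (table c X₀) x = true := by
  unfold certF at h
  simp only [Bool.and_eq_true, decide_eq_true_eq] at h
  exact h

/-- The stabiliser orbit sums vanish, in the form the engine consumes (any `S`). -/
theorem orbit_sums_ofF {S : Finset (GLm p 3)} {c : ZMod p} {X₀ : V p}
    (horth : (S.filter fun k : GLm p 3 => ¬ (((k : Mat p 3))ᵀ * (k : Mat p 3) = 1 ∧
      det3 (k : Mat p 3) * det3 (k : Mat p 3) = 1)) = ∅)
    (htab : ∀ v : V p, wtab (table c X₀) v = wt c X₀ v)
    (htest : ∀ x : V p, nrm x = true → orbitTestF S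
      ((Finset.univ : Finset (V p)).filter fun ω => ω ⬝ᵥ ω = c) (table c X₀) x = true) :
    ∀ x : V p, x ≠ 0 → ∀ ω : V p,
      (∑ s ∈ S.filter (fun s : GLm p 3 => (s : Mat p 3) *ᵥ x = x), wt c X₀ (act s ω)) = 0 := by
  intro x hx ω
  obtain ⟨t, ht, hN⟩ := exists_nrm x hx
  rw [← filter_smul S ht x]
  by_cases hω : ω ⬝ᵥ ω = c
  · have h := htest (t • x) hN
    unfold orbitTestF at h
    simp only [decide_eq_true_eq] at h
    have h' := Finset.filter_eq_empty_iff.mp h (Finset.mem_filter.mpr ⟨Finset.mem_univ ω, hω⟩)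
    simp only [htab, not_not] at h'
    exact h'
  · refine Finset.sum_eq_zero fun s hs => wt_off ?_
    have hk := not_not.mp (Finset.filter_eq_empty_iff.mp horth (Finset.mem_filter.mp hs).1)
    rwa [dot_act hk.1 hk.2]

/-! ## The exclusions -/

section Exclusions

variable {m : ℕ} {σ : Bool} {c : ZMod p} {X₀ : V p}

/-- **COVER FORM.**  A verified fast certificate excludes every triple whose product set covers
the class minus `1`. -/
theorem no_design_of_certF {H₁ H₂ H₃ : Subgroup (GLm p 3)} (hc : certF (KSF p σ) σ c X₀ = true)
    (hmem : ∀ k ∈ classGroup p σ, k ≠ 1 → ∃ a ∈ H₁, ∃ b ∈ H₂, ∃ g ∈ H₃, a * b * g = k) :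
    ¬ ∃ f : Mat p 3 → ℂ, (∀ M, 1 < M.rank → f M = 0) ∧
      (∑ M, f M * ZMod.stdAddChar (Matrix.trace (M * ((1 : GLm p 3) : Mat p 3)))) = 1 ∧
      ∀ a ∈ H₁, ∀ b ∈ H₂, ∀ g ∈ H₃, a * b * g ≠ 1 →
        (∑ M, f M * ZMod.stdAddChar (Matrix.trace (M * ((a * b * g : GLm p 3) : Mat p 3)))) = 0 :=
  by
  have hc' := certF_spec hc
  exact no_design_of_permCert (KSF p σ) (one_mem_KSF σ) (KSF_mul_of_step hc'.1)
    (inv_of_filter hc'.2.1) act act_mul act_one (wt c X₀) ⟨X₀, hc'.2.2.2.1⟩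
    (orbit_sums_ofF hc'.2.2.1 hc'.2.2.2.2.1 hc'.2.2.2.2.2)
    fun k hk hk1 => hmem k (KSF_sub (H := classGroup p σ)
      (fun b hb0 hb => Subgroup.subset_closure ⟨b, hb0, hb, rfl⟩) k hk) hk1

/-- **SQUARE CLASS: once `certF (KSF p true) true c X₀ = true` is evaluated, NO MEMBER OF A TRIPLE
IN `GL_m(𝔽_p)`, `m ≥ 3`, CONTAINS ALL SQUARE REFLECTIONS of `𝔽_p^m`** (three coordinates
suffice): member `1`. -/
theorem no_design_sq_mem₁_of_certF (hc : certF (KSF p true) true c X₀ = true) (hm : 3 ≤ m)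
    {H₁ H₂ H₃ : Subgroup (GLm p m)}
    (h₁ : ∀ b : Fin m → ZMod p, b ⬝ᵥ b ≠ 0 → IsSquare (b ⬝ᵥ b) → refl b ∈ H₁) :
    ¬ ∃ f : Mat p m → ℂ, (∀ M, 1 < M.rank → f M = 0) ∧
      (∑ M, f M * ZMod.stdAddChar (Matrix.trace (M * ((1 : GLm p m) : Mat p m)))) = 1 ∧
      ∀ a ∈ H₁, ∀ b ∈ H₂, ∀ g ∈ H₃, a * b * g ≠ 1 →
        (∑ M, f M * ZMod.stdAddChar (Matrix.trace (M * ((a * b * g : GLm p m) : Mat p m)))) = 0 :=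
  by
  obtain ⟨l, rfl⟩ := Nat.exists_eq_add_of_le hm
  intro hdes
  refine no_design_of_certF (H₁ := H₁.comap (emb finSumFinEquiv))
    (H₂ := H₂.comap (emb finSumFinEquiv)) (H₃ := H₃.comap (emb finSumFinEquiv)) hc
    (triple_of_le₁ ((Subgroup.closure_le _).mpr ?_)) (design_comap finSumFinEquiv 1 hdes)
  rintro _ ⟨b, hb0, hb, rfl⟩
  refine Subgroup.mem_comap.mpr ?_
  rw [emb_refl]
  exact h₁ _ (by rwa [extVec_dotProduct]) (by rw [extVec_dotProduct]; exact of_decide_eq_true hb)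

/-- Square class, member `2`. -/
theorem no_design_sq_mem₂_of_certF (hc : certF (KSF p true) true c X₀ = true) (hm : 3 ≤ m)
    {H₁ H₂ H₃ : Subgroup (GLm p m)}
    (h₂ : ∀ b : Fin m → ZMod p, b ⬝ᵥ b ≠ 0 → IsSquare (b ⬝ᵥ b) → refl b ∈ H₂) :
    ¬ ∃ f : Mat p m → ℂ, (∀ M, 1 < M.rank → f M = 0) ∧
      (∑ M, f M * ZMod.stdAddChar (Matrix.trace (M * ((1 : GLm p m) : Mat p m)))) = 1 ∧
      ∀ a ∈ H₁, ∀ b ∈ H₂, ∀ g ∈ H₃, a * b * g ≠ 1 →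
        (∑ M, f M * ZMod.stdAddChar (Matrix.trace (M * ((a * b * g : GLm p m) : Mat p m)))) = 0 :=
  by
  obtain ⟨l, rfl⟩ := Nat.exists_eq_add_of_le hm
  intro hdes
  refine no_design_of_certF (H₁ := H₁.comap (emb finSumFinEquiv))
    (H₂ := H₂.comap (emb finSumFinEquiv)) (H₃ := H₃.comap (emb finSumFinEquiv)) hc
    (triple_of_le₂ ((Subgroup.closure_le _).mpr ?_)) (design_comap finSumFinEquiv 1 hdes)
  rintro _ ⟨b, hb0, hb, rfl⟩
  refine Subgroup.mem_comap.mpr ?_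
  rw [emb_refl]
  exact h₂ _ (by rwa [extVec_dotProduct]) (by rw [extVec_dotProduct]; exact of_decide_eq_true hb)

/-- Square class, member `3`. -/
theorem no_design_sq_mem₃_of_certF (hc : certF (KSF p true) true c X₀ = true) (hm : 3 ≤ m)
    {H₁ H₂ H₃ : Subgroup (GLm p m)}
    (h₃ : ∀ b : Fin m → ZMod p, b ⬝ᵥ b ≠ 0 → IsSquare (b ⬝ᵥ b) → refl b ∈ H₃) :
    ¬ ∃ f : Mat p m → ℂ, (∀ M, 1 < M.rank → f M = 0) ∧
      (∑ M, f M * ZMod.stdAddChar (Matrix.trace (M * ((1 : GLm p m) : Mat p m)))) = 1 ∧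
      ∀ a ∈ H₁, ∀ b ∈ H₂, ∀ g ∈ H₃, a * b * g ≠ 1 →
        (∑ M, f M * ZMod.stdAddChar (Matrix.trace (M * ((a * b * g : GLm p m) : Mat p m)))) = 0 :=
  by
  obtain ⟨l, rfl⟩ := Nat.exists_eq_add_of_le hm
  intro hdes
  refine no_design_of_certF (H₁ := H₁.comap (emb finSumFinEquiv))
    (H₂ := H₂.comap (emb finSumFinEquiv)) (H₃ := H₃.comap (emb finSumFinEquiv)) hc
    (triple_of_le₃ ((Subgroup.closure_le _).mpr ?_)) (design_comap finSumFinEquiv 1 hdes)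
  rintro _ ⟨b, hb0, hb, rfl⟩
  refine Subgroup.mem_comap.mpr ?_
  rw [emb_refl]
  exact h₃ _ (by rwa [extVec_dotProduct]) (by rw [extVec_dotProduct]; exact of_decide_eq_true hb)

/-- **NON-SQUARE CLASS: once `certF (KSF p false) false c X₀ = true` is evaluated, no member of a
triple in `GL_m(𝔽_p)`, `m ≥ 3`, contains all non-square reflections**: member `1`. -/
theorem no_design_nsq_mem₁_of_certF (hc : certF (KSF p false) false c X₀ = true) (hm : 3 ≤ m)
    {H₁ H₂ H₃ : Subgroup (GLm p m)}
    (h₁ : ∀ b : Fin m → ZMod p, ¬ IsSquare (b ⬝ᵥ b) → refl b ∈ H₁) :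
    ¬ ∃ f : Mat p m → ℂ, (∀ M, 1 < M.rank → f M = 0) ∧
      (∑ M, f M * ZMod.stdAddChar (Matrix.trace (M * ((1 : GLm p m) : Mat p m)))) = 1 ∧
      ∀ a ∈ H₁, ∀ b ∈ H₂, ∀ g ∈ H₃, a * b * g ≠ 1 →
        (∑ M, f M * ZMod.stdAddChar (Matrix.trace (M * ((a * b * g : GLm p m) : Mat p m)))) = 0 :=
  by
  obtain ⟨l, rfl⟩ := Nat.exists_eq_add_of_le hm
  intro hdes
  refine no_design_of_certF (H₁ := H₁.comap (emb finSumFinEquiv))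
    (H₂ := H₂.comap (emb finSumFinEquiv)) (H₃ := H₃.comap (emb finSumFinEquiv)) hc
    (triple_of_le₁ ((Subgroup.closure_le _).mpr ?_)) (design_comap finSumFinEquiv 1 hdes)
  rintro _ ⟨b, -, hb, rfl⟩
  refine Subgroup.mem_comap.mpr ?_
  rw [emb_refl]
  exact h₁ _ (by rw [extVec_dotProduct]; exact of_decide_eq_false hb)

/-- Non-square class, member `2`. -/
theorem no_design_nsq_mem₂_of_certF (hc : certF (KSF p false) false c X₀ = true) (hm : 3 ≤ m)
    {H₁ H₂ H₃ : Subgroup (GLm p m)}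
    (h₂ : ∀ b : Fin m → ZMod p, ¬ IsSquare (b ⬝ᵥ b) → refl b ∈ H₂) :
    ¬ ∃ f : Mat p m → ℂ, (∀ M, 1 < M.rank → f M = 0) ∧
      (∑ M, f M * ZMod.stdAddChar (Matrix.trace (M * ((1 : GLm p m) : Mat p m)))) = 1 ∧
      ∀ a ∈ H₁, ∀ b ∈ H₂, ∀ g ∈ H₃, a * b * g ≠ 1 →
        (∑ M, f M * ZMod.stdAddChar (Matrix.trace (M * ((a * b * g : GLm p m) : Mat p m)))) = 0 :=
  by
  obtain ⟨l, rfl⟩ := Nat.exists_eq_add_of_le hm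
  intro hdes
  refine no_design_of_certF (H₁ := H₁.comap (emb finSumFinEquiv))
    (H₂ := H₂.comap (emb finSumFinEquiv)) (H₃ := H₃.comap (emb finSumFinEquiv)) hc
    (triple_of_le₂ ((Subgroup.closure_le _).mpr ?_)) (design_comap finSumFinEquiv 1 hdes)
  rintro _ ⟨b, -, hb, rfl⟩
  refine Subgroup.mem_comap.mpr ?_
  rw [emb_refl]
  exact h₂ _ (by rw [extVec_dotProduct]; exact of_decide_eq_false hb)

/-- Non-square class, member `3`. -/
theorem no_design_nsq_mem₃_of_certF (hc : certF (KSF p false) false c X₀ = true) (hm : 3 ≤ m)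
    {H₁ H₂ H₃ : Subgroup (GLm p m)}
    (h₃ : ∀ b : Fin m → ZMod p, ¬ IsSquare (b ⬝ᵥ b) → refl b ∈ H₃) :
    ¬ ∃ f : Mat p m → ℂ, (∀ M, 1 < M.rank → f M = 0) ∧
      (∑ M, f M * ZMod.stdAddChar (Matrix.trace (M * ((1 : GLm p m) : Mat p m)))) = 1 ∧
      ∀ a ∈ H₁, ∀ b ∈ H₂, ∀ g ∈ H₃, a * b * g ≠ 1 →
        (∑ M, f M * ZMod.stdAddChar (Matrix.trace (M * ((a * b * g : GLm p m) : Mat p m)))) = 0 :=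
  by
  obtain ⟨l, rfl⟩ := Nat.exists_eq_add_of_le hm
  intro hdes
  refine no_design_of_certF (H₁ := H₁.comap (emb finSumFinEquiv))
    (H₂ := H₂.comap (emb finSumFinEquiv)) (H₃ := H₃.comap (emb finSumFinEquiv)) hc
    (triple_of_le₃ ((Subgroup.closure_le _).mpr ?_)) (design_comap finSumFinEquiv 1 hdes)
  rintro _ ⟨b, -, hb, rfl⟩
  refine Subgroup.mem_comap.mpr ?_
  rw [emb_refl]
  exact h₃ _ (by rw [extVec_dotProduct]; exact of_decide_eq_false hb)

end Exclusions

end ReflectionClassCertificateFast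
end Summit.MatrixMultiplication.MatrixMultiplication.Theorems.SubgroupIdentityDesigns.Negative
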